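import Summits.CriticalPhenomena.SAWScalingLimit.Theorems.SAWDevelopingMapHexTightArcTightOfPinchDecay
import HarnessLib

/-!
# Stub `stub_rootedTightOfPinchDecay` of the line `reversal-virgin-disc` (crux `HexTight`, stmt-CriticalPhenomena-5423)

Landing target
`Summits/CriticalPhenomena/SAWScalingLimit/Theorems/SAWDevelopingMapHexTightRootedTightOfPinchDecay.lean`
(skeleton r8). Objects (`IsHArc`, `arcCurve`, `arcMass`, `travMass`, `Straddles`, `IsVirgin`) from
`SAWDevelopingMapHexTightReversalDefs.lean`; the named hypothesis `TravLocalization` from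
`SAWDevelopingMapHexTightPinchDefs.lean`; the `arcMass` / `travMass` API (`arcTight_arcMass_nonneg`,
`arcTight_travMass_mono`, `arcTight_travMass_le_sum`, `arcTight_dist_netPoint`) from
`SAWDevelopingMapHexTightArcTightOfPinch.lean`; the net cover with thresholds and the real arithmetic
of the union bound (`arcTightDecay_cover`, `arcTightDecay_ratio_le`, `arcTightDecay_union_le`) from the
chordal twin `SAWDevelopingMapHexTightArcTightOfPinchDecay.lean`, of which this file is the ROOTED
version (and the r8 generalisation of `SAWDevelopingMapHexTightRootedTightOfPinch.lean`).
WHAT: ROOTED TRAVERSAL TIGHTNESS FROM PINCH DECAY — traversal localization (`TravLocalization`) and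
the r8 interior atom `PinchDecay` (for SOME threshold `k ≥ 1`, SOME nonnegative rate `φ` with
`φ(t) = o(t)` as `t → 0⁺` and SOME `N_p`: uniformly over configurations virgin at radius `N ≥ N_p`
and rim doors, `travMass_k(D(z₀; η, N/2)) ≤ φ(η/N) · arcMass` for `1 ≤ η ≤ N/4`) imply the rate-free
ROOTED tightness `RootedTraversalTight`: at each aspect `A ≥ 4` and tolerance `η > 0` there is a
threshold `k₀` such that, uniformly over virgin configurations at radius `N ≥ N₀`, rim doors `w` and
lattice root steps `q ∼ p` into a deep root `p` (`dist(c(p), z₀) ≤ N/A ≤ N/4`), the `H`-arcs of the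
punctured domain `Λ ∖ {p}` from `w` to the mid-edge `{q, p}` whose polyline traverses `D(z₀; N/A, N/2)`
by `k₀` separate segments carry at most `η` of the arc mass. HOW: `{q, p} = {p, q}` with `p ∉ Λ ∖ {p}`,
`p ∼ q`, so the rooted class is a door-to-door class of `Λ₀ := Λ ∖ {p}` in the format of
`TravLocalization` (`u' := p`, `c' := q`). Lattice units, `N = 16 M'`, net size `M`, `e = π M' / M`:
`k₀ = Σ_{j<M} k` separate traversals of `D(z₀; N/A, N/2) ⊇ D(z₀; 6M', 8M')` localize
(`arcTightDecay_cover`, Aizenman–Burchard net localization WITH THRESHOLDS) to `k` separate traversals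
of `D(y_j; 14e, M' - 14e)` about one of the `M` net points `y_j` of the middle circle `|y - z₀| = 7M'`;
union bound `arcTight_travMass_le_sum`; about each net point the PUNCTURED configuration is virgin at
radius `M' + 2` (that disc lies in the annulus `6M' - 2 < |· - z₀| < 8M' + 2`, inside the virgin
`16M'`-disc and off the root, which is within `4M'` of `z₀`), both `u` and `p` are `> M' + 2` away from
`y_j`, so `TravLocalization` fed with `PinchDecay` on the sub-configurations charges each net point
`φ(t₁) · arcMass`, `t₁ = (14e+2)/(M'+2)` (`rootedTightDecay_netPoint`); and `t₁ ≤ 200/M ≤ t₀`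
(`arcTightDecay_ratio_le`), where `φ(t) ≤ (η/400) t` on `(0, t₀]`, gives `M φ(t₁) ≤ η/2 ≤ η`
(`arcTightDecay_union_le`). Constants: `M = ⌈2000 + 200/t₀⌉₊`, `N₀ = 16 max(N_p, M)`.
-/

noncomputable section

open scoped BigOperators Classical
open Literature.Probability.LatticeModels Literature.Probability.RandomPlanarGeometry
  Literature.Probability.RandomPlanarGeometry.SAW

namespace Summit.CriticalPhenomena.SAWScalingLimit.Theorems.HexTight.Reversal

/-! ## One net point of the rooted class: localization + pinch decay -/

/-- **The charge of one net point, rooted class.** In a configuration `(H, Λ)` virgin at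
`(z₀, 16M')`, `M' ≥ 2000`, `M' ≥ N_p`, with a rim door `{u, c}` (`u ∉ Λ`, `|c(u) - z₀| > 16M'`) and a
deep root `p` (`|c(p) - z₀| ≤ 16M'/A ≤ 4M'`, `q ∼ p`), for a centre `y` on the middle circle
`|y - z₀| = 7M'` and `0 ≤ 500 e ≤ M'`: the punctured configuration `(H, Λ ∖ {p})` is virgin at
`(y, M' + 2)`, both `u` and `p` are `> M' + 2` away from `y`, so traversal localization at
`(y, r₁ = M' + 2)` reduces the `k`-traversal mass of `D(y; 14e, M' - 14e)` of the rooted class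
`{u, c} → {p, q}` to the sub-configurations' `k`-traversal masses of
`D(y; 14e + 2, M' - 14e - 2) ⊆ D(y; 14e + 2, (M'+2)/2)`-events, which pinch decay at radius `M' + 2`,
inner radius `14e + 2 ∈ [1, (M'+2)/4]`, charges `φ((14e+2)/(M'+2))`. -/
theorem rootedTightDecay_netPoint (hTL : TravLocalization) {k : ℕ} {φ : ℝ → ℝ} {Np : ℝ}
    (hk1 : 1 ≤ k) (hφ0 : ∀ t : ℝ, 0 ≤ φ t)
    (hP : ∀ (H : SimpleGraph HexVertex) (Λ : Finset HexVertex) (z₀ : ℂ) (η N : ℝ)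
      (w w' : Sym2 HexVertex), Np ≤ N → 1 ≤ η → η ≤ N / 4 →
      IsVirgin H Λ z₀ N → Straddles Λ z₀ N w → Straddles Λ z₀ N w' →
      travMass H Λ w w' k z₀ η (N / 2) ≤ φ (η / N) * arcMass H Λ w w')
    {H : SimpleGraph HexVertex} {Λ : Finset HexVertex} {z₀ y : ℂ} {M' A e : ℝ}
    {u c p q : HexVertex} (hNp : Np ≤ M') (hM : 2000 ≤ M') (he0 : 0 ≤ e) (he : 500 * e ≤ M')
    (hy : dist y z₀ = 7 * M') (hV : IsVirgin H Λ z₀ (16 * M')) (hA : 4 ≤ A) (hu : u ∉ Λ)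
    (huc : hexGraph.Adj u c) (huN : 16 * M' < dist (hexCenter u) z₀)
    (hp : dist (hexCenter p) z₀ ≤ 16 * M' / A) (hqp : hexGraph.Adj q p) :
    travMass H (Λ.erase p) s(u, c) s(p, q) k y (14 * e) (M' - 14 * e) ≤
      φ ((14 * e + 2) / (M' + 2)) * arcMass H (Λ.erase p) s(u, c) s(p, q) := by
  have hM'0 : 0 < M' := by linarith
  -- the root is deep: within `4M'` of `z₀`
  have hpN : dist (hexCenter p) z₀ ≤ 4 * M' := by
    have h4 : 16 * M' / A ≤ 16 * M' / 4 :=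
      div_le_div_of_nonneg_left (by positivity) (by norm_num) hA
    linarith
  have hu' : u ∉ Λ.erase p := fun h => hu (Finset.mem_of_mem_erase h)
  have hp' : p ∉ Λ.erase p := Finset.notMem_erase p Λ
  -- the door vertex and the root are outside the `r₁`-circle about `y`
  have hyu : M' + 2 < dist (hexCenter u) y := by
    have := dist_triangle (hexCenter u) y z₀
    linarith
  have hyp : M' + 2 < dist (hexCenter p) y := by
    have := dist_triangle y (hexCenter p) z₀
    rw [dist_comm y (hexCenter p)] at this
    linarith
  -- the punctured configuration is virgin about `y` at radius `r₁ = M' + 2`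
  have hVy : IsVirgin H (Λ.erase p) y (M' + 2) := by
    refine ⟨fun v hv => ?_, fun v v' hv hv' hvv' => ?_⟩
    · have h1 := dist_triangle (hexCenter v) y z₀
      refine Finset.mem_erase.2 ⟨fun hvp => ?_, hV.mem v (by linarith)⟩
      rw [hvp] at hv
      linarith
    · have h1 := dist_triangle (hexCenter v) y z₀
      have h2 := dist_triangle (hexCenter v') y z₀
      exact hV.adj v v' (by linarith) (by linarith) hvv'
  refine hTL H (Λ.erase p) y (M' + 2) (14 * e) (M' - 14 * e) _ k u c p q hk1 (hφ0 _) (by linarith)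
    (by linarith) (by linarith) hu' hp' huc hqp.symm hyu hyp hVy ?_
  intro Λ' m m' _ hV' hm hm'
  calc travMass H Λ' m m' k y (14 * e + 2) (M' - 14 * e - 2)
      ≤ travMass H Λ' m m' k y (14 * e + 2) ((M' + 2) / 2) :=
        arcTight_travMass_mono le_rfl (by linarith)
    _ ≤ φ ((14 * e + 2) / (M' + 2)) * arcMass H Λ' m m' :=
        hP H Λ' y (14 * e + 2) (M' + 2) m m' (by linarith) (by linarith) (by linarith) hV' hm hm'

/-! ## The registered stub -/

/-- **stub E' — ROOTED TIGHTNESS FROM PINCH DECAY** (`= TravLocalization → PinchDecay →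
RootedTraversalTight`, skeleton r8): net localization with thresholds on the middle circle + union
bound + localization on the punctured configuration `Λ ∖ {p}`. With `PinchDecay`'s `(k, φ, N_p)` and
`t₀ > 0` such that `φ(t) ≤ (η/400) t` on `(0, t₀]`: net size `M = ⌈2000 + 200 / t₀⌉₊`, threshold
`k₀ = Σ_{j<M} k`, `N₀ = 16 max(N_p, M)`; for `N = 16M' ≥ N₀` the `k₀`-traversal mass of
`D(z₀; N/A, N/2)` of the rooted class `w → {q, p} = {p, q}` is at most `Σ_{j<M}` (`k`-traversal mass
of `D(y_j; 14e, M' - 14e)` about the net point `y_j`, `e = πM'/M`)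
`≤ M · φ((14e+2)/(M'+2)) · arcMass ≤ (η/2) · arcMass ≤ η · arcMass`. -/
theorem stub_rootedTightOfPinchDecay :
    TravLocalization →
    (∃ (k : ℕ) (φ : ℝ → ℝ) (N₀ : ℝ), 1 ≤ k ∧ 0 < N₀ ∧ (∀ t : ℝ, 0 ≤ φ t) ∧
      (∀ ε : ℝ, 0 < ε → ∃ t₀ : ℝ, 0 < t₀ ∧ ∀ t : ℝ, 0 < t → t ≤ t₀ → φ t ≤ ε * t) ∧
      ∀ (H : SimpleGraph HexVertex) (Λ : Finset HexVertex) (z₀ : ℂ) (η N : ℝ)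
        (w w' : Sym2 HexVertex), N₀ ≤ N → 1 ≤ η → η ≤ N / 4 →
        IsVirgin H Λ z₀ N → Straddles Λ z₀ N w → Straddles Λ z₀ N w' →
        travMass H Λ w w' k z₀ η (N / 2) ≤ φ (η / N) * arcMass H Λ w w') →
    ∀ A : ℝ, 4 ≤ A → ∀ η : ℝ, 0 < η → ∃ (k₀ : ℕ) (N₀ : ℝ), 0 < N₀ ∧
      ∀ (H : SimpleGraph HexVertex) (Λ : Finset HexVertex) (z₀ : ℂ) (N : ℝ)
        (w : Sym2 HexVertex) (p q : HexVertex), N₀ ≤ N →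
        IsVirgin H Λ z₀ N → Straddles Λ z₀ N w → dist (hexCenter p) z₀ ≤ N / A →
        hexGraph.Adj q p → H.Adj q p →
        travMass H (Λ.erase p) w s(q, p) k₀ z₀ (N / A) (N / 2) ≤
          η * arcMass H (Λ.erase p) w s(q, p) := by
  intro hTL hP A hA η hη
  obtain ⟨k, φ, Np, hk1, hNp, hφ0, hφo, hPb⟩ := hP
  -- the rate: `φ t ≤ (η/400) t` on `(0, t₀]`
  obtain ⟨t₀, ht₀, hφt⟩ := hφo (η / 400) (by positivity)
  -- the net size `M`
  set M : ℕ := ⌈2000 + 200 / t₀⌉₊ with hM_def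
  have hMceil : (2000 : ℝ) + 200 / t₀ ≤ M := Nat.le_ceil _
  have hM2000 : (2000 : ℝ) ≤ M := by linarith [div_nonneg (by norm_num : (0 : ℝ) ≤ 200) ht₀.le]
  have hMpos : (0 : ℝ) < M := by linarith
  have hM1 : 1 ≤ M := by exact_mod_cast (show (1 : ℝ) ≤ M by linarith)
  have hMt : 200 / (M : ℝ) ≤ t₀ := by
    have h : 200 / t₀ ≤ M := by linarith
    rw [div_le_iff₀ ht₀] at h
    rw [div_le_iff₀ hMpos]
    linarith [mul_comm (M : ℝ) t₀]
  refine ⟨∑ _j ∈ Finset.range M, k, 16 * max Np (M : ℝ), by positivity, ?_⟩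
  intro H Λ z₀ N w p q hN hV hw hp hqp _
  obtain ⟨M', rfl⟩ : ∃ M', N = 16 * M' := ⟨N / 16, by ring⟩
  have hmax : max Np (M : ℝ) ≤ M' := by linarith
  have hNpM' : Np ≤ M' := le_trans (le_max_left _ _) hmax
  have hMM' : (M : ℝ) ≤ M' := le_trans (le_max_right _ _) hmax
  have hM'2000 : 2000 ≤ M' := le_trans hM2000 hMM'
  have hM'0 : 0 < M' := by linarith
  obtain ⟨u, c, rfl, huc, hu, -, -, huN⟩ := hw
  rw [show s(q, p) = s(p, q) from Sym2.eq_swap]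
  -- the small parameter `e = π M' / M`
  set e : ℝ := Real.pi * M' / M with he_def
  have he0 : 0 ≤ e := by positivity
  have heM : e * M = Real.pi * M' := div_mul_cancel₀ _ hMpos.ne'
  have he : 500 * e ≤ M' := by
    have h1 : Real.pi * M' ≤ 4 * M' := mul_le_mul_of_nonneg_right Real.pi_le_four hM'0.le
    have h2 : (2000 : ℝ) * M' ≤ M * M' := mul_le_mul_of_nonneg_right hM2000 hM'0.le
    have h3 : 500 * e * M ≤ M' * M := by nlinarith
    exact le_of_mul_le_mul_right h3 hMpos
  -- the charge of one net point: `φ t₁`, `t₁ = (14e+2)/(M'+2) ≤ 200/M ≤ t₀`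
  set t₁ : ℝ := (14 * e + 2) / (M' + 2) with ht₁_def
  have ht₁0 : 0 < t₁ := by positivity
  have ht₁M : t₁ ≤ 200 / M := arcTightDecay_ratio_le hMpos hMM' heM
  have hMφ : (M : ℝ) * φ t₁ ≤ η / 2 :=
    arcTightDecay_union_le hη hMpos (hφt t₁ ht₁0 (ht₁M.trans hMt)) ht₁M
  -- the net points
  set y : ℕ → ℂ := fun i => z₀ + ((7 * M' : ℝ) : ℂ) *
    Complex.exp (((-Real.pi + 2 * Real.pi * i / M : ℝ) : ℂ) * Complex.I) with hy_def
  have hyd : ∀ i, dist (y i) z₀ = 7 * M' := fun i => arcTight_dist_netPoint hM'0.le M i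
  calc travMass H (Λ.erase p) s(u, c) s(p, q) (∑ _j ∈ Finset.range M, k) z₀ (16 * M' / A)
        (16 * M' / 2)
      ≤ ∑ i ∈ Finset.range M,
          travMass H (Λ.erase p) s(u, c) s(p, q) k (y i) (14 * e) (M' - 14 * e) := by
        refine arcTight_travMass_le_sum fun γ hγ => ?_
        obtain ⟨i, hi, h⟩ := arcTightDecay_cover hM'0 hA hM1 hγ
        exact ⟨i, Finset.mem_range.2 hi, h⟩
    _ ≤ ∑ _i ∈ Finset.range M, φ t₁ * arcMass H (Λ.erase p) s(u, c) s(p, q) :=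
        Finset.sum_le_sum fun i _ =>
          rootedTightDecay_netPoint hTL hk1 hφ0 hPb hNpM' hM'2000 he0 he (hyd i) hV hA hu huc huN
            hp hqp
    _ = (M : ℝ) * φ t₁ * arcMass H (Λ.erase p) s(u, c) s(p, q) := by
        rw [Finset.sum_const, Finset.card_range, nsmul_eq_mul]
        ring
    _ ≤ η * arcMass H (Λ.erase p) s(u, c) s(p, q) :=
        mul_le_mul_of_nonneg_right (by linarith) arcTight_arcMass_nonneg

end Summit.CriticalPhenomena.SAWScalingLimit.Theorems.HexTight.Reversal

end
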